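import Literature.Geometry.Symplectic.HondaModelChartAxis
import Literature.Geometry.Symplectic.NearSymplecticDefinite
import HarnessLib

/-!
# Transport of the first-order zero data of a `2`-form under pull-back by an immersion `ℝ⁴ → M`

Topic `Literature/Geometry/Symplectic` (groundwork `--supports`
`Literature.Geometry.Symplectic.relNearSymplecticTaubesTubes_exists`; everything here is PROVED,
no named fact is introduced).

Step H-b0 of the normal form along an even zero circle of a strictly near-symplectic form
(Honda 2004, §4 Thm. 5; Perutz 2006, Lemma 3.1): the construction of the Honda chart is carried
out on a flat tube `ℝ_θ × ℝ³` after pulling the form back along a tubular immersion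
`χ : ℝ⁴ ⊇ U → M`; this file transports the pointwise data at a zero through such a pull-back,
at a point `q` where `χ` is `C^∞` nearby and `dχ_q` is bijective (Perutz 2006, Def. 1.1: all
notions are intrinsic at a zero, i.e. invariant under local diffeomorphisms).  The differential
is packaged as an endomorphism `flatDifferential χ q` of `ℝ⁴` (the tangent spaces of the flat
source and of the chart at `χ q` both being `ℝ⁴`), so that the linear algebra of
`PfaffianFour.lean` applies verbatim:

* `pullback_apply_eq_zero_iff` — `(χ^*sf)(q) = 0 ↔ sf(χ q) = 0`;
* `zeroGradient_pullback_eq_comp` — `∇_W(χ^*sf)(q) = dχ_q^* (∇_{dχ_q W} sf(χ q))`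
  (`zeroGradient_pullback_apply_of_eq_zero` of `HondaModelChartAxis.lean`, as `2`-forms);
* `zeroGradient_pullback_eq_zero_iff`, `finrank_range_zeroGradient_pullback`,
  `IsTransverseZero.pullback` — the kernel is `dχ_q⁻¹(ker)`, the rank is unchanged, transverse
  zeros pull back to transverse zeros;
* `pfaffian_zeroGradient_pullback` — `Pf(∇_W(χ^*sf)) = det(dχ_q) · Pf(∇_{dχ_q W} sf)`, hence a
  definite gradient image stays definite, the sign being multiplied by `sign det(dχ_q)`
  (`definite_zeroGradient_pullback`);
* `zeroNormalForm_pullback`, `isMinorityVector_pullback_iff` — Perutz's form `S` and its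
  minority vectors are transported by `dχ_q`.

## References

* T. Perutz, *Zero-sets of near-symplectic forms*, J. Symplectic Geom. 4 (2006), Def. 1.1,
  §2.3, Lemma 3.1 [Perutz2006].
* K. Honda, *Local properties of self-dual harmonic 2-forms on a 4-manifold*, J. reine angew.
  Math. 577 (2004), §4 Thm. 5 [Honda2004LocalSD].
-/

noncomputable section

open scoped Manifold ContDiff Topology
open Set Function Filter Module Literature.Geometry.Kaehler Literature.Topology.FourManifolds

namespace Literature.Geometry.Symplectic

/-- Local notation for the model space `ℝ⁴ = EuclideanSpace ℝ (Fin 4)`. -/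
local notation "E4" => EuclideanSpace ℝ (Fin 4)

/-! ### Linear algebra: pull-back of a `2`-form along a surjection -/

/-- Pulling a `2`-form on `ℝ⁴` back along a SURJECTIVE endomorphism kills it only if it is zero.
[folklore] -/
theorem compContinuousLinearMap_eq_zero_iff (α : E4 [⋀^Fin 2]→L[ℝ] ℝ) {L : E4 →L[ℝ] E4}
    (hL : Surjective L) : α.compContinuousLinearMap L = 0 ↔ α = 0 := by
  constructor
  · intro h
    ext v
    choose w hw using fun i => hL (v i)
    have h' := DFunLike.congr_fun h w
    rw [ContinuousAlternatingMap.compContinuousLinearMap_apply] at h'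
    have hv : (⇑L ∘ w) = v := funext hw
    rw [hv] at h'
    exact h'
  · rintro rfl
    ext v
    rfl

variable {M : Type*} [TopologicalSpace M] [ChartedSpace E4 M] {sf : MForm (𝓡 4) M ℝ 2}
  {χ : E4 → M} {q : E4}

/-- **The differential of `χ : ℝ⁴ → M` at `q` as an endomorphism of `ℝ⁴`**: `mfderiv` from the
flat source, with values in the tangent space at `χ q` read in the preferred chart (both are
`ℝ⁴`; this packaging lets the linear algebra of `ℝ⁴` — `LinearMap.det`, `pfaffian` — apply without
coercions between `TangentSpace` types). [folklore] -/
def flatDifferential (χ : E4 → M) (q : E4) : E4 →L[ℝ] E4 := mfderiv 𝓘(ℝ, E4) (𝓡 4) χ q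

/-- Unfolding `flatDifferential`. [folklore] -/
@[simp] theorem flatDifferential_apply (χ : E4 → M) (q v : E4) :
    flatDifferential χ q v = mfderiv 𝓘(ℝ, E4) (𝓡 4) χ q v := rfl

/-- `flatDifferential` is `mfderiv` (as terms). [folklore] -/
theorem flatDifferential_eq (χ : E4 → M) (q : E4) :
    flatDifferential χ q = mfderiv 𝓘(ℝ, E4) (𝓡 4) χ q := rfl

/-! ### The value at a point -/

/-- **Zeros are preserved and reflected**: if `dχ_q` is surjective then `(χ^*sf)(q) = 0` iff
`sf(χ q) = 0`. [cite: Perutz2006, Def. 1.1] -/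
theorem pullback_apply_eq_zero_iff (hL : Surjective (flatDifferential χ q)) :
    sf.pullback 𝓘(ℝ, E4) χ q = 0 ↔ sf (χ q) = 0 := by
  have key : sf.pullback 𝓘(ℝ, E4) χ q = (sf (χ q)).compContinuousLinearMap (flatDifferential χ q) :=
    rfl
  rw [key]
  exact compContinuousLinearMap_eq_zero_iff _ hL

/-- The pull-back vanishes wherever the form vanishes at the image point. [folklore] -/
theorem pullback_apply_eq_zero (h0 : sf (χ q) = 0) : sf.pullback 𝓘(ℝ, E4) χ q = 0 := by
  ext v
  rw [MForm.pullback_apply, h0]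
  rfl

variable [IsManifold (𝓡 4) ∞ M]

/-! ### The gradient at a zero -/

/-- **The gradient of the pull-back at a zero, as a `2`-form**:
`∇_W(χ^*sf)(q) = (∇_{dχ_q W} sf)(χ q) ∘ (dχ_q × dχ_q)`. [cite: Perutz2006, Def. 1.1] -/
theorem zeroGradient_pullback_eq_comp (hχ : ∀ᶠ z in 𝓝 q, ContMDiffAt 𝓘(ℝ, E4) (𝓡 4) ∞ χ z)
    (hsf : sf.SmoothAt (χ q)) (h0 : sf (χ q) = 0) (W : E4) :
    zeroGradient (sf.pullback 𝓘(ℝ, E4) χ) q W =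
      (zeroGradient sf (χ q) (flatDifferential χ q W)).compContinuousLinearMap
        (flatDifferential χ q) := by
  ext v
  rw [zeroGradient_pullback_apply_of_eq_zero hχ hsf h0 W v]
  rfl

/-- **Kernel of the transported gradient**: if `dχ_q` is surjective, `∇_W(χ^*sf)(q) = 0` iff
`∇_{dχ_q W} sf(χ q) = 0`. [cite: Perutz2006, Def. 1.1] -/
theorem zeroGradient_pullback_eq_zero_iff (hχ : ∀ᶠ z in 𝓝 q, ContMDiffAt 𝓘(ℝ, E4) (𝓡 4) ∞ χ z)
    (hsf : sf.SmoothAt (χ q)) (h0 : sf (χ q) = 0) (hL : Surjective (flatDifferential χ q))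
    (W : E4) :
    zeroGradient (sf.pullback 𝓘(ℝ, E4) χ) q W = 0 ↔
      zeroGradient sf (χ q) (flatDifferential χ q W) = 0 := by
  rw [zeroGradient_pullback_eq_comp hχ hsf h0 W]
  exact compContinuousLinearMap_eq_zero_iff _ hL

/-- **The rank of the gradient is unchanged** under pull-back by a local diffeomorphism
(`ker ∇(χ^*sf)(q) = dχ_q⁻¹ ker ∇sf(χ q)` and rank–nullity in `ℝ⁴`). [cite: Perutz2006, Def. 1.1] -/
theorem finrank_range_zeroGradient_pullback
    (hχ : ∀ᶠ z in 𝓝 q, ContMDiffAt 𝓘(ℝ, E4) (𝓡 4) ∞ χ z) (hsf : sf.SmoothAt (χ q))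
    (h0 : sf (χ q) = 0) (hL : Bijective (flatDifferential χ q)) :
    Module.finrank ℝ (LinearMap.range (zeroGradient (sf.pullback 𝓘(ℝ, E4) χ) q).toLinearMap) =
      Module.finrank ℝ (LinearMap.range (zeroGradient sf (χ q)).toLinearMap) := by
  set G₀ := zeroGradient (sf.pullback 𝓘(ℝ, E4) χ) q with hG₀
  set G := zeroGradient sf (χ q) with hG
  set Le : E4 ≃ₗ[ℝ] E4 :=
    LinearEquiv.ofBijective ((flatDifferential χ q : E4 →L[ℝ] E4) : E4 →ₗ[ℝ] E4) hL with hLe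
  have hker : LinearMap.ker G₀.toLinearMap =
      (LinearMap.ker G.toLinearMap).comap (Le : E4 →ₗ[ℝ] E4) := by
    ext W
    simp only [LinearMap.mem_ker, Submodule.mem_comap, ContinuousLinearMap.coe_coe, hLe]
    exact zeroGradient_pullback_eq_zero_iff hχ hsf h0 hL.2 W
  have hfk : Module.finrank ℝ (LinearMap.ker G₀.toLinearMap) =
      Module.finrank ℝ (LinearMap.ker G.toLinearMap) := by
    rw [hker, Submodule.comap_equiv_eq_map_symm, LinearEquiv.finrank_map_eq]
  have h₀ := LinearMap.finrank_range_add_finrank_ker G₀.toLinearMap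
  have h₁ := LinearMap.finrank_range_add_finrank_ker G.toLinearMap
  rw [finrank_euclideanSpace_fin] at h₀ h₁
  omega

/-- **Transverse zeros pull back to transverse zeros** along a map that is `C^∞` near `q` with
bijective differential. [cite: Perutz2006, Def. 1.1] -/
theorem IsTransverseZero.pullback (h : IsTransverseZero sf (χ q))
    (hχ : ∀ᶠ z in 𝓝 q, ContMDiffAt 𝓘(ℝ, E4) (𝓡 4) ∞ χ z) (hsf : sf.SmoothAt (χ q))
    (hL : Bijective (flatDifferential χ q)) :
    IsTransverseZero (sf.pullback 𝓘(ℝ, E4) χ) q :=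
  ⟨pullback_apply_eq_zero h.1, by rw [finrank_range_zeroGradient_pullback hχ hsf h.1 hL, h.2]⟩

/-! ### The Pfaffian of the gradient: definiteness -/

/-- **`Pf(∇_W(χ^*sf)(q)) = det(dχ_q) · Pf(∇_{dχ_q W} sf(χ q))`** (functoriality of the
Pfaffian, `pfaffian_compContinuousLinearMap`). [cite: Perutz2006, Def. 1.1] -/
theorem pfaffian_zeroGradient_pullback (hχ : ∀ᶠ z in 𝓝 q, ContMDiffAt 𝓘(ℝ, E4) (𝓡 4) ∞ χ z)
    (hsf : sf.SmoothAt (χ q)) (h0 : sf (χ q) = 0) (W : E4) :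
    pfaffian (zeroGradient (sf.pullback 𝓘(ℝ, E4) χ) q W) =
      LinearMap.det ((flatDifferential χ q : E4 →L[ℝ] E4) : E4 →ₗ[ℝ] E4) *
        pfaffian (zeroGradient sf (χ q) (flatDifferential χ q W)) := by
  rw [zeroGradient_pullback_eq_comp hχ hsf h0 W]
  exact pfaffian_compContinuousLinearMap _ _

omit [IsManifold (𝓡 4) ∞ M] in
/-- The differential of a local diffeomorphism has non-zero determinant. [folklore] -/
theorem det_flatDifferential_ne_zero (hL : Bijective (flatDifferential χ q)) :
    LinearMap.det ((flatDifferential χ q : E4 →L[ℝ] E4) : E4 →ₗ[ℝ] E4) ≠ 0 := by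
  have hu : IsUnit ((flatDifferential χ q : E4 →L[ℝ] E4) : E4 →ₗ[ℝ] E4) :=
    (LinearMap.isUnit_iff_ker_eq_bot _).2 (LinearMap.ker_eq_bot.2 hL.1)
  exact ((LinearMap.isUnit_iff_isUnit_det _).1 hu).ne_zero

/-- **A definite gradient image stays definite under pull-back**: if the non-zero values of
`∇sf(χ q)` have Pfaffian of sign `s`, then the non-zero values of `∇(χ^*sf)(q)` have Pfaffian of
sign `s · sign det(dχ_q)` (written as `if 0 < det then s else -s`).
[cite: Perutz2006, Def. 1.1] -/
theorem definite_zeroGradient_pullback (hχ : ∀ᶠ z in 𝓝 q, ContMDiffAt 𝓘(ℝ, E4) (𝓡 4) ∞ χ z)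
    (hsf : sf.SmoothAt (χ q)) (h0 : sf (χ q) = 0) (hL : Bijective (flatDifferential χ q)) {s : ℝ}
    (hdef : ∀ v : E4, zeroGradient sf (χ q) v ≠ 0 → 0 < s * pfaffian (zeroGradient sf (χ q) v))
    (W : E4) (hW : zeroGradient (sf.pullback 𝓘(ℝ, E4) χ) q W ≠ 0) :
    0 < (if 0 < LinearMap.det ((flatDifferential χ q : E4 →L[ℝ] E4) : E4 →ₗ[ℝ] E4)
          then s else -s) *
      pfaffian (zeroGradient (sf.pullback 𝓘(ℝ, E4) χ) q W) := by
  set d : ℝ := LinearMap.det ((flatDifferential χ q : E4 →L[ℝ] E4) : E4 →ₗ[ℝ] E4) with hd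
  have hdet : d ≠ 0 := det_flatDifferential_ne_zero hL
  have hW' : zeroGradient sf (χ q) (flatDifferential χ q W) ≠ 0 := fun h =>
    hW ((zeroGradient_pullback_eq_zero_iff hχ hsf h0 hL.2 W).2 h)
  have hpos := hdef _ hW'
  set P := pfaffian (zeroGradient sf (χ q) (flatDifferential χ q W)) with hP
  rw [pfaffian_zeroGradient_pullback hχ hsf h0 W]
  split_ifs with hdpos
  · have : 0 < d * (s * P) := mul_pos hdpos hpos
    linarith [this, show s * (d * P) = d * (s * P) by ring]
  · have hd' : d < 0 := lt_of_le_of_ne (not_lt.1 hdpos) hdet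
    have : 0 < -d * (s * P) := mul_pos (neg_pos.2 hd') hpos
    linarith [this, show -s * (d * P) = -d * (s * P) by ring]

/-! ### Perutz's form `S` and minority vectors -/

/-- **Perutz's form is transported by `dχ_q`**:
`S^{χ^*sf}_q(τ; v, w) = S^{sf}_{χ q}(dχ τ; dχ v, dχ w)`. [cite: Perutz2006, §2.3] -/
theorem zeroNormalForm_pullback (hχ : ∀ᶠ z in 𝓝 q, ContMDiffAt 𝓘(ℝ, E4) (𝓡 4) ∞ χ z)
    (hsf : sf.SmoothAt (χ q)) (h0 : sf (χ q) = 0) (τ v w : E4) :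
    zeroNormalForm (sf.pullback 𝓘(ℝ, E4) χ) q τ v w =
      zeroNormalForm sf (χ q) (flatDifferential χ q τ) (flatDifferential χ q v)
        (flatDifferential χ q w) := by
  rw [zeroNormalForm_apply, zeroNormalForm_apply, zeroGradient_pullback_apply_of_eq_zero hχ hsf h0]
  congr 1
  ext i
  fin_cases i <;> rfl

/-- **Minority vectors are transported by `dχ_q`** (surjective): `v` is a minority vector of
`S^{χ^*sf}_q(τ)` iff `dχ_q v` is one of `S^{sf}_{χ q}(dχ_q τ)`. [cite: Perutz2006, §2.3] -/
theorem isMinorityVector_pullback_iff (hχ : ∀ᶠ z in 𝓝 q, ContMDiffAt 𝓘(ℝ, E4) (𝓡 4) ∞ χ z)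
    (hsf : sf.SmoothAt (χ q)) (h0 : sf (χ q) = 0) (hL : Surjective (flatDifferential χ q))
    (τ v : E4) :
    IsMinorityVector (zeroNormalForm (sf.pullback 𝓘(ℝ, E4) χ) q τ) v ↔
      IsMinorityVector (zeroNormalForm sf (χ q) (flatDifferential χ q τ))
        (flatDifferential χ q v) := by
  simp only [IsMinorityVector, zeroNormalForm_pullback hχ hsf h0]
  refine and_congr Iff.rfl ⟨fun h w => ?_, fun h w => h _⟩
  obtain ⟨w', rfl⟩ := hL w
  exact h w'

end Literature.Geometry.Symplectic

end
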